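import Summits.ResolutionOfSingularities.ResolutionOfSingularities.Theorems.EquisingularLiftEquisingularLiftNatNDInitialFormCalculus
import Summits.ResolutionOfSingularities.ResolutionOfSingularities.Theorems.EquisingularLiftEquisingularLiftNatSpecimenS10
import HarnessLib

/-!
# [OURS · L1 W4.5(b) · EL♮(3) · D3-6 (b′)] `S10` IS NON-ND IN EVERY POLYNOMIAL FRAME — part 1/2 (`…NatSpecimenS10AllFramesSteps`):
# the weight computations `(2,2,1)` (STEP 3) and `(2,1,1)` (STEP 2); STEP 1 `(1,1,1)` and the assembly are in the sequel

Cell `res-hironaka`, crux EL♮(3) `EquisingularLiftNatThree` (stmt-ResolutionOfSingularities-20148), chain W4.5b, line `sections`; WIDTH TABLE D3 row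
D3-6 (b′) (desk RULING 2026-08-28T17:46Z on res-L1-w45b-iso-w1 g2's TAKING; signatures pre-cleared by res-L1-w45b-crit-2).  OURS; NOT a statement of any
manuscript; nothing of [Hironaka2017] is asserted; AI-written kernel algebra, weaker than expert review.  Def-free, `sorry`-free, standard axioms.
`--kind proof --supports stmt-ResolutionOfSingularities-20148 --as helper`.

WHAT.  res-L1-w45b-lead-1's customer `S10 = (x² + y²z)² + x⁵ + z⁶ + xy⁸ + x¹⁰ + y¹⁰ + z¹⁰` of the isolated research residue (memo
`RESIDUE-CUSTOMER-S10.md`, kernel anchor ✓ `…NatSpecimenS10`: convenient, NOT locally Newton-nondegenerate IN THE GIVEN FRAME) is claimed there (§3 Lemma,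
by hand, via the blow-up) to be non-ND in EVERY frame — the numbered claim (H1) of D3-6 at the empty prefix.  This module and its sequel prove the
POLYNOMIAL-FRAME form in the kernel by INITIAL FORMS ONLY: for every substitution `φ = (φ₀, φ₁, φ₂)` of polynomials without constant term whose linear
parts are linearly independent, `S10(φ₀, φ₁, φ₂)` fails Kouchnirenko's local condition at one of three positive weights.  Writing `ℓ_x, ℓ_y, ℓ_z` for the
linear parts and `t₀, t₁, t₂` for the new variables:
* STEP 1 (`S10AllFrames.step1` in the sequel, weight `(1,1,1)`): `in = ℓ_x⁴` (the tangent cone `x⁴` transported); if `ℓ_x` has two monomials it has a torus zero and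
  `ℓ_x⁴ = ℓ_x²·ℓ_x²` is singular there.  Otherwise `ℓ_x = α t_i`.
* STEP 2 (`S10AllFrames.step2A`, `ℓ_x = α t₀`, weight `(2,1,1)`): `in = m_z²·(m_y⁴ + m_z⁴)` (`m_y`, `m_z` = `ℓ_y`, `ℓ_z` without their `t₀`-terms, linearly
  independent); if `m_z` has two monomials this is singular along its torus zeros.  Otherwise `m_z = β t_j`.
* STEP 3 (`S10AllFrames.step3`, `ℓ_x = α t₀`, `m_z = β t₁`, `γ = ∂ℓ_y/∂t₂ ≠ 0`, weight `(2,2,1)`): `in = P²` with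
  `P = (α t₀ + a₂ t₂²)² + γ² t₂² (b t₀ + β t₁ + c₂ t₂²) ∋ α² t₀², βγ² t₁ t₂²` — a square of a binomial-containing form, singular along `P = 0`.
Each step ends in ✓ `ND.not_isLocallyND_of_initialForm_eq_sq_mul` (`…NatNDInitialFormCalculus`, over res-L1-w45b-nose-w1's `ND.exists_torus_zero`); the
weight bookkeeping is the `wtGe_*`/`wtEq_*` calculus and `ND.initialForm_eq_of_add_wtGe` of that module.  The sequel `…NatSpecimenS10AllFrames` assembles
the steps (transpositions of the variables via `ND.isLocallyNewtonNondegenerate_rename_iff`, the `3 × 3` determinant) into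
`∀ φ, (∀ j, φⱼ(0) = 0) → det (∂φⱼ/∂tᵢ(0)) ≠ 0 → ¬ IsLocallyNewtonNondegenerate (aeval φ S10)` and the `AlgEquiv`/`FixesOrigin` form.

HONEST SCOPE.  Germ level, `k` algebraically closed (any characteristic).  The `IsoHypND`-level negation for the projective surface `V₊(S10ʰ)` needs in
addition `IsZeroSetOf` + irreducibility of `S10ʰ` — NOT claimed.  Dim-3 char-p resolution is a theorem in print (Cossart–Piltant 2008/2009); this is
OUR kernel-own bookkeeping for OUR engine's residue, counted 0 toward the summit; EL♮(3) is NOT proved here.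
-/

set_option linter.dupNamespace false

noncomputable section


open MvPolynomial

namespace Summit.ResolutionOfSingularities.ResolutionOfSingularities.Cruxes.EquisingularLiftNat.Sections

open ND

variable {k : Type} [Field k]

namespace S10AllFrames

/-! ## §1 Bookkeeping on `Fin 3`: single-variable exponents, the three weights, the substituted specimen -/

/-- `t₀^n` as an `eG3`. [OURS · bookkeeping] -/
theorem single_zero_eq_eG3 (n : ℕ) : (Finsupp.single 0 n : Fin 3 →₀ ℕ) = eG3 n 0 0 := by
  ext i; fin_cases i <;> simp [eG3_apply_zero, eG3_apply_one, eG3_apply_two]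

/-- `t₁^n` as an `eG3`. [OURS · bookkeeping] -/
theorem single_one_eq_eG3 (n : ℕ) : (Finsupp.single 1 n : Fin 3 →₀ ℕ) = eG3 0 n 0 := by
  ext i; fin_cases i <;> simp [eG3_apply_zero, eG3_apply_one, eG3_apply_two]

/-- `t₂^n` as an `eG3`. [OURS · bookkeeping] -/
theorem single_two_eq_eG3 (n : ℕ) : (Finsupp.single 2 n : Fin 3 →₀ ℕ) = eG3 0 0 n := by
  ext i; fin_cases i <;> simp [eG3_apply_zero, eG3_apply_one, eG3_apply_two]

/-- `0` as an `eG3`. [OURS · bookkeeping] -/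
theorem zero_eq_eG3 : (0 : Fin 3 →₀ ℕ) = eG3 0 0 0 := by
  ext i; fin_cases i <;> simp [eG3_apply_zero, eG3_apply_one, eG3_apply_two]

/-- The weight `(1,1,1)` of `x^a y^b z^c`. [OURS · bookkeeping] -/
theorem wt_w111_eG3 (a b c : ℕ) : wt (fun _ : Fin 3 => (1 : ℤ)) (eG3 a b c) = a + b + c := by
  simp [wt, Fin.sum_univ_three, eG3_apply_zero, eG3_apply_one, eG3_apply_two]

/-- The weight `(2,1,1)` of `x^a y^b z^c`. [OURS · bookkeeping] -/
theorem wt_w211_eG3 (a b c : ℕ) : wt (![2, 1, 1] : Fin 3 → ℤ) (eG3 a b c) = 2 * a + b + c := by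
  simp [wt, Fin.sum_univ_three, eG3_apply_zero, eG3_apply_one, eG3_apply_two]

/-- The weight `(2,2,1)` of `x^a y^b z^c`. [OURS · bookkeeping] -/
theorem wt_w221_eG3 (a b c : ℕ) : wt (![2, 2, 1] : Fin 3 → ℤ) (eG3 a b c) = 2 * a + 2 * b + c := by
  simp [wt, Fin.sum_univ_three, eG3_apply_zero, eG3_apply_one, eG3_apply_two]

/-- **The substituted specimen**: `S10(φ₀, φ₁, φ₂) = (φ₀² + φ₁²φ₂)² + φ₀⁵ + φ₂⁶ + φ₀φ₁⁸ + φ₀¹⁰ + φ₁¹⁰ + φ₂¹⁰`. [OURS · bookkeeping] -/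
theorem aeval_specimenS10 (φ : Fin 3 → MvPolynomial (Fin 3) k) :
    aeval φ (specimenS10 k) =
      (φ 0 ^ 2 + φ 1 ^ 2 * φ 2) ^ 2 + φ 0 ^ 5 + φ 2 ^ 6 + φ 0 * φ 1 ^ 8 + φ 0 ^ 10 + φ 1 ^ 10 + φ 2 ^ 10 := by
  simp only [specimenS10, map_add, map_pow, map_mul, aeval_X]

/-- The constant coefficient is the coefficient of `eG3 0 0 0`. [OURS · bookkeeping] -/
theorem coeff_eG3_zero_eq_constantCoeff (P : MvPolynomial (Fin 3) k) : coeff (eG3 0 0 0) P = constantCoeff P := by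
  rw [← zero_eq_eG3]; rfl

/-! ## §2 STEP 3 — the normal form `ℓ_x = α·t₀`, `ℓ_z = b·t₀ + β·t₁`, `γ = ∂ℓ_y/∂t₂ ≠ 0`: the weight `(2,2,1)` exhibits `in = P²` -/

/-- **STEP 3.**  If the linear part of `φ₀` is `α t₀` (`α ≠ 0`), the linear part of `φ₂` has no `t₂` and `t₁`-coefficient `β ≠ 0`, and the
`t₂`-coefficient `γ` of the linear part of `φ₁` is non-zero, then `S10 ∘ φ` is NOT locally Newton-nondegenerate: for the weight `Ω = (2,2,1)` the
initial form is the SQUARE `P²`, `P = (α t₀ + a₂ t₂²)² + γ² t₂² (b t₀ + β t₁ + c₂ t₂²)` (`a₂`, `c₂` the `t₂²`-coefficients of `φ₀`, `φ₂`; `b` the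
`t₀`-coefficient of `φ₂`), and `P ∋ α² t₀², βγ² t₁t₂²` has two monomials. [OURS · L1 W4.5b · D3-6 (b′)] -/
theorem step3 [IsAlgClosed k] (φ : Fin 3 → MvPolynomial (Fin 3) k) (h0 : ∀ j, constantCoeff (φ j) = 0) {α β γ : k}
    (hα : α ≠ 0) (hβ : β ≠ 0) (hγ : γ ≠ 0)
    (hx0 : coeff (Finsupp.single 0 1) (φ 0) = α) (hx1 : coeff (Finsupp.single 1 1) (φ 0) = 0)
    (hx2 : coeff (Finsupp.single 2 1) (φ 0) = 0) (hy2 : coeff (Finsupp.single 2 1) (φ 1) = γ)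
    (hz1 : coeff (Finsupp.single 1 1) (φ 2) = β) (hz2 : coeff (Finsupp.single 2 1) (φ 2) = 0) :
    ¬ IsLocallyNewtonNondegenerate (aeval φ (specimenS10 k)) := by
  classical
  rw [single_zero_eq_eG3] at hx0
  rw [single_one_eq_eG3] at hx1 hz1
  rw [single_two_eq_eG3] at hx2 hy2 hz2
  -- names
  set X₁ := φ 0 with hX₁
  set Y₁ := φ 1 with hY₁
  set Z₁ := φ 2 with hZ₁
  set a₂ : k := coeff (eG3 0 0 2) X₁ with ha₂
  set b : k := coeff (eG3 1 0 0) Z₁ with hb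
  set c₂ : k := coeff (eG3 0 0 2) Z₁ with hc₂
  set Ω : Fin 3 → ℤ := ![2, 2, 1] with hΩ
  have hΩpos : ∀ i, 0 < Ω i := by intro i; fin_cases i <;> simp [hΩ]
  -- the leading parts
  set x₀ : MvPolynomial (Fin 3) k := monomial (eG3 1 0 0) α + monomial (eG3 0 0 2) a₂ with hx₀
  set y₀ : MvPolynomial (Fin 3) k := monomial (eG3 0 0 1) γ with hy₀
  set z₀ : MvPolynomial (Fin 3) k := monomial (eG3 1 0 0) b + monomial (eG3 0 1 0) β + monomial (eG3 0 0 2) c₂ with hz₀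
  set A' := X₁ - x₀ with hA'
  set B' := Y₁ - y₀ with hB'
  set C' := Z₁ - z₀ with hC'
  -- constant coefficients
  have hX0 : coeff (eG3 0 0 0) X₁ = 0 := by rw [coeff_eG3_zero_eq_constantCoeff]; exact h0 0
  have hY0 : coeff (eG3 0 0 0) Y₁ = 0 := by rw [coeff_eG3_zero_eq_constantCoeff]; exact h0 1
  have hZ0 : coeff (eG3 0 0 0) Z₁ = 0 := by rw [coeff_eG3_zero_eq_constantCoeff]; exact h0 2
  -- the remainders are heavy
  have hA'wt : ∀ m ∈ A'.support, (3 : ℤ) ≤ wt Ω m := by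
    rw [wtGe_iff_coeff_eq_zero]
    intro m hm
    obtain ⟨p, q, r, rfl⟩ : ∃ p q r, m = eG3 p q r := ⟨m 0, m 1, m 2, (eG3_eta m).symm⟩
    rw [wt_w221_eG3] at hm
    have hcases : (p = 0 ∧ q = 0 ∧ r = 0) ∨ (p = 0 ∧ q = 0 ∧ r = 1) ∨ (p = 0 ∧ q = 0 ∧ r = 2) ∨ (p = 1 ∧ q = 0 ∧ r = 0) ∨
        (p = 0 ∧ q = 1 ∧ r = 0) := by omega
    rcases hcases with ⟨rfl, rfl, rfl⟩ | ⟨rfl, rfl, rfl⟩ | ⟨rfl, rfl, rfl⟩ | ⟨rfl, rfl, rfl⟩ | ⟨rfl, rfl, rfl⟩ <;>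
      simp [hA', hx₀, coeff_monomial, eG3_eq_iff, hX0, hx0, hx1, hx2, ha₂]
  have hB'wt : ∀ m ∈ B'.support, (2 : ℤ) ≤ wt Ω m := by
    rw [wtGe_iff_coeff_eq_zero]
    intro m hm
    obtain ⟨p, q, r, rfl⟩ : ∃ p q r, m = eG3 p q r := ⟨m 0, m 1, m 2, (eG3_eta m).symm⟩
    rw [wt_w221_eG3] at hm
    have hcases : (p = 0 ∧ q = 0 ∧ r = 0) ∨ (p = 0 ∧ q = 0 ∧ r = 1) := by omega
    rcases hcases with ⟨rfl, rfl, rfl⟩ | ⟨rfl, rfl, rfl⟩ <;>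
      simp [hB', hy₀, coeff_monomial, eG3_eq_iff, hY0, hy2]
  have hC'wt : ∀ m ∈ C'.support, (3 : ℤ) ≤ wt Ω m := by
    rw [wtGe_iff_coeff_eq_zero]
    intro m hm
    obtain ⟨p, q, r, rfl⟩ : ∃ p q r, m = eG3 p q r := ⟨m 0, m 1, m 2, (eG3_eta m).symm⟩
    rw [wt_w221_eG3] at hm
    have hcases : (p = 0 ∧ q = 0 ∧ r = 0) ∨ (p = 0 ∧ q = 0 ∧ r = 1) ∨ (p = 0 ∧ q = 0 ∧ r = 2) ∨ (p = 1 ∧ q = 0 ∧ r = 0) ∨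
        (p = 0 ∧ q = 1 ∧ r = 0) := by omega
    rcases hcases with ⟨rfl, rfl, rfl⟩ | ⟨rfl, rfl, rfl⟩ | ⟨rfl, rfl, rfl⟩ | ⟨rfl, rfl, rfl⟩ | ⟨rfl, rfl, rfl⟩ <;>
      simp [hC', hz₀, coeff_monomial, eG3_eq_iff, hZ0, hz1, hz2, hb, hc₂]
  -- the leading parts are light (homogeneous)
  have hx₀wt : ∀ m ∈ x₀.support, wt Ω m = 2 := by
    refine wtEq_add ?_ ?_
    · intro m hm; rw [wtEq_monomial Ω _ _ m hm, wt_w221_eG3]; norm_num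
    · intro m hm; rw [wtEq_monomial Ω _ _ m hm, wt_w221_eG3]; norm_num
  have hy₀wt : ∀ m ∈ y₀.support, wt Ω m = 1 := by
    intro m hm; rw [wtEq_monomial Ω _ _ m hm, wt_w221_eG3]; norm_num
  have hz₀wt : ∀ m ∈ z₀.support, wt Ω m = 2 := by
    refine wtEq_add (wtEq_add ?_ ?_) ?_
    · intro m hm; rw [wtEq_monomial Ω _ _ m hm, wt_w221_eG3]; norm_num
    · intro m hm; rw [wtEq_monomial Ω _ _ m hm, wt_w221_eG3]; norm_num
    · intro m hm; rw [wtEq_monomial Ω _ _ m hm, wt_w221_eG3]; norm_num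
  have hx₀ge : ∀ m ∈ x₀.support, (2 : ℤ) ≤ wt Ω m := fun m hm => (hx₀wt m hm).symm.le
  have hy₀ge : ∀ m ∈ y₀.support, (1 : ℤ) ≤ wt Ω m := fun m hm => (hy₀wt m hm).symm.le
  have hz₀ge : ∀ m ∈ z₀.support, (2 : ℤ) ≤ wt Ω m := fun m hm => (hz₀wt m hm).symm.le
  -- hence the substituted variables weigh `2, 1, 2`
  have hX₁eq : X₁ = x₀ + A' := by rw [hA']; ring
  have hY₁eq : Y₁ = y₀ + B' := by rw [hB']; ring
  have hZ₁eq : Z₁ = z₀ + C' := by rw [hC']; ring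
  have hX₁wt : ∀ m ∈ X₁.support, (2 : ℤ) ≤ wt Ω m := by
    rw [hX₁eq]; exact wtGe_add hx₀ge (wtGe_mono (by norm_num) hA'wt)
  have hY₁wt : ∀ m ∈ Y₁.support, (1 : ℤ) ≤ wt Ω m := by
    rw [hY₁eq]; exact wtGe_add hy₀ge (wtGe_mono (by norm_num) hB'wt)
  have hZ₁wt : ∀ m ∈ Z₁.support, (2 : ℤ) ≤ wt Ω m := by
    rw [hZ₁eq]; exact wtGe_add hz₀ge (wtGe_mono (by norm_num) hC'wt)
  -- the candidate initial form `P²`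
  set P := x₀ ^ 2 + y₀ ^ 2 * z₀ with hP
  have hPwt : ∀ m ∈ P.support, wt Ω m = 4 := by
    refine wtEq_add ?_ ?_
    · intro m hm; rw [wtEq_pow hx₀wt 2 m hm]; norm_num
    · intro m hm; rw [wtEq_mul (wtEq_pow hy₀wt 2) hz₀wt m hm]; norm_num
  have hP2wt : ∀ m ∈ (P ^ 2).support, wt Ω m = 8 := by
    intro m hm; rw [wtEq_pow hPwt 2 m hm]; norm_num
  have hPge : ∀ m ∈ P.support, (4 : ℤ) ≤ wt Ω m := fun m hm => (hPwt m hm).symm.le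
  -- the monomial expansion of `P`
  have hPexp : P = monomial (eG3 2 0 0) (α ^ 2) + monomial (eG3 1 0 2) (2 * α * a₂ + γ ^ 2 * b) +
      monomial (eG3 0 0 4) (a₂ ^ 2 + γ ^ 2 * c₂) + monomial (eG3 0 1 2) (β * γ ^ 2) := by
    simp only [hP, hx₀, hy₀, hz₀, monomial_eG3, map_add, map_mul, map_pow, map_ofNat]
    ring
  have hcoeffP : ∀ d, coeff d P = (if eG3 2 0 0 = d then α ^ 2 else 0) + (if eG3 1 0 2 = d then 2 * α * a₂ + γ ^ 2 * b else 0) +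
      (if eG3 0 0 4 = d then a₂ ^ 2 + γ ^ 2 * c₂ else 0) + (if eG3 0 1 2 = d then β * γ ^ 2 else 0) := by
    intro d; simp only [hPexp, coeff_add, coeff_monomial]
  have hPa : eG3 2 0 0 ∈ P.support := by
    rw [mem_support_iff, hcoeffP]; simp [eG3_eq_iff]; exact hα
  have hPb : eG3 0 1 2 ∈ P.support := by
    rw [mem_support_iff, hcoeffP]; simp [eG3_eq_iff]; exact ⟨hβ, hγ⟩
  have hP0 : P ≠ 0 := fun h => by rw [h] at hPa; simp at hPa
  have hP20 : P ^ 2 ≠ 0 := pow_ne_zero 2 hP0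
  -- the remainder and its weight
  set q₁ := X₁ ^ 2 + Y₁ ^ 2 * Z₁ with hq₁
  set R₄ := A' * (X₁ + x₀) + B' * (Y₁ + y₀) * Z₁ + y₀ ^ 2 * C' with hR₄
  have hq₁eq : q₁ = P + R₄ := by
    rw [hq₁, hP, hR₄, hX₁eq, hY₁eq, hZ₁eq]; ring
  have hR₄wt : ∀ m ∈ R₄.support, (5 : ℤ) ≤ wt Ω m := by
    refine wtGe_add (wtGe_add ?_ ?_) ?_
    · have := wtGe_mul hA'wt (wtGe_add hX₁wt hx₀ge); exact wtGe_mono (by norm_num) this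
    · have := wtGe_mul (wtGe_mul hB'wt (wtGe_add hY₁wt hy₀ge)) hZ₁wt; exact wtGe_mono (by norm_num) this
    · have := wtGe_mul (wtGe_pow hy₀ge 2) hC'wt; exact wtGe_mono (by norm_num) this
  have hq₁wt : ∀ m ∈ q₁.support, (4 : ℤ) ≤ wt Ω m := by
    rw [hq₁eq]; exact wtGe_add hPge (wtGe_mono (by norm_num) hR₄wt)
  set r := R₄ * (q₁ + P) + X₁ ^ 5 + Z₁ ^ 6 + X₁ * Y₁ ^ 8 + X₁ ^ 10 + Y₁ ^ 10 + Z₁ ^ 10 with hr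
  have hrwt : ∀ m ∈ r.support, (8 : ℤ) + 1 ≤ wt Ω m := by
    refine wtGe_add (wtGe_add (wtGe_add (wtGe_add (wtGe_add (wtGe_add ?_ ?_) ?_) ?_) ?_) ?_) ?_
    · have := wtGe_mul hR₄wt (wtGe_add hq₁wt hPge); exact wtGe_mono (by norm_num) this
    · have := wtGe_pow hX₁wt 5; exact wtGe_mono (by norm_num) this
    · have := wtGe_pow hZ₁wt 6; exact wtGe_mono (by norm_num) this
    · have := wtGe_mul hX₁wt (wtGe_pow hY₁wt 8); exact wtGe_mono (by norm_num) this
    · have := wtGe_pow hX₁wt 10; exact wtGe_mono (by norm_num) this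
    · have := wtGe_pow hY₁wt 10; exact wtGe_mono (by norm_num) this
    · have := wtGe_pow hZ₁wt 10; exact wtGe_mono (by norm_num) this
  have hg : aeval φ (specimenS10 k) = P ^ 2 + r := by
    rw [aeval_specimenS10, ← hX₁, ← hY₁, ← hZ₁, hr]
    have : (X₁ ^ 2 + Y₁ ^ 2 * Z₁) ^ 2 = P ^ 2 + R₄ * (q₁ + P) := by
      rw [← hq₁, hq₁eq]; ring
    rw [this]; ring
  have hin : initialForm Ω (aeval φ (specimenS10 k)) = P ^ 2 * 1 := by
    rw [mul_one]; exact initialForm_eq_of_add_wtGe Ω hg hP20 hP2wt hrwt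
  exact not_isLocallyND_of_initialForm_eq_sq_mul hΩpos hin hPa hPb (by simp [eG3_eq_iff])

/-! ## §3 STEP 2 — `ℓ_x ⊆ k·t₀` and the linear part of `φ₂` modulo `t₀` is a BINOMIAL: the weight `(2,1,1)` exhibits `in = m_z²·(m_y⁴ + m_z⁴)` -/

/-- **STEP 2 (binomial case).**  If the linear part of `φ₀` has no `t₁`, `t₂`, the linear parts `m_y`, `m_z` of `φ₁`, `φ₂` modulo `t₀` are linearly
independent, and `m_z = q₁ t₁ + q₂ t₂` with `q₁ q₂ ≠ 0`, then `S10 ∘ φ` is NOT locally Newton-nondegenerate: for `Ω = (2,1,1)` the initial form is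
`m_z² · (m_y⁴ + m_z⁴)` and `m_z` is a binomial. [OURS · L1 W4.5b · D3-6 (b′)] -/
theorem step2A [IsAlgClosed k] (φ : Fin 3 → MvPolynomial (Fin 3) k) (h0 : ∀ j, constantCoeff (φ j) = 0)
    (hx1 : coeff (Finsupp.single 1 1) (φ 0) = 0) (hx2 : coeff (Finsupp.single 2 1) (φ 0) = 0)
    (hq₁ : coeff (Finsupp.single 1 1) (φ 2) ≠ 0) (hq₂ : coeff (Finsupp.single 2 1) (φ 2) ≠ 0)
    (hδ : coeff (Finsupp.single 1 1) (φ 1) * coeff (Finsupp.single 2 1) (φ 2) -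
      coeff (Finsupp.single 1 1) (φ 2) * coeff (Finsupp.single 2 1) (φ 1) ≠ 0) :
    ¬ IsLocallyNewtonNondegenerate (aeval φ (specimenS10 k)) := by
  classical
  rw [single_one_eq_eG3] at hx1 hq₁ hδ
  rw [single_two_eq_eG3] at hx2 hq₂ hδ
  set X₁ := φ 0 with hX₁
  set Y₁ := φ 1 with hY₁
  set Z₁ := φ 2 with hZ₁
  set p₁ : k := coeff (eG3 0 1 0) Y₁ with hp₁
  set p₂ : k := coeff (eG3 0 0 1) Y₁ with hp₂
  set q₁ : k := coeff (eG3 0 1 0) Z₁ with hq₁'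
  set q₂ : k := coeff (eG3 0 0 1) Z₁ with hq₂'
  set Ω : Fin 3 → ℤ := ![2, 1, 1] with hΩ
  have hΩpos : ∀ i, 0 < Ω i := by intro i; fin_cases i <;> simp [hΩ]
  set my : MvPolynomial (Fin 3) k := monomial (eG3 0 1 0) p₁ + monomial (eG3 0 0 1) p₂ with hmy
  set mz : MvPolynomial (Fin 3) k := monomial (eG3 0 1 0) q₁ + monomial (eG3 0 0 1) q₂ with hmz
  set B₁ := Y₁ - my with hB₁
  set C₁ := Z₁ - mz with hC₁
  have hX0 : coeff (eG3 0 0 0) X₁ = 0 := by rw [coeff_eG3_zero_eq_constantCoeff]; exact h0 0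
  have hY0 : coeff (eG3 0 0 0) Y₁ = 0 := by rw [coeff_eG3_zero_eq_constantCoeff]; exact h0 1
  have hZ0 : coeff (eG3 0 0 0) Z₁ = 0 := by rw [coeff_eG3_zero_eq_constantCoeff]; exact h0 2
  -- weights of the pieces
  have hX₁wt : ∀ m ∈ X₁.support, (2 : ℤ) ≤ wt Ω m := by
    rw [wtGe_iff_coeff_eq_zero]
    intro m hm
    obtain ⟨p, q, r, rfl⟩ : ∃ p q r, m = eG3 p q r := ⟨m 0, m 1, m 2, (eG3_eta m).symm⟩
    rw [wt_w211_eG3] at hm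
    have hcases : (p = 0 ∧ q = 0 ∧ r = 0) ∨ (p = 0 ∧ q = 1 ∧ r = 0) ∨ (p = 0 ∧ q = 0 ∧ r = 1) := by omega
    rcases hcases with ⟨rfl, rfl, rfl⟩ | ⟨rfl, rfl, rfl⟩ | ⟨rfl, rfl, rfl⟩
    · exact hX0
    · exact hx1
    · exact hx2
  have hB₁wt : ∀ m ∈ B₁.support, (2 : ℤ) ≤ wt Ω m := by
    rw [wtGe_iff_coeff_eq_zero]
    intro m hm
    obtain ⟨p, q, r, rfl⟩ : ∃ p q r, m = eG3 p q r := ⟨m 0, m 1, m 2, (eG3_eta m).symm⟩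
    rw [wt_w211_eG3] at hm
    have hcases : (p = 0 ∧ q = 0 ∧ r = 0) ∨ (p = 0 ∧ q = 1 ∧ r = 0) ∨ (p = 0 ∧ q = 0 ∧ r = 1) := by omega
    rcases hcases with ⟨rfl, rfl, rfl⟩ | ⟨rfl, rfl, rfl⟩ | ⟨rfl, rfl, rfl⟩ <;>
      simp [hB₁, hmy, coeff_monomial, eG3_eq_iff, hY0, hp₁, hp₂]
  have hC₁wt : ∀ m ∈ C₁.support, (2 : ℤ) ≤ wt Ω m := by
    rw [wtGe_iff_coeff_eq_zero]
    intro m hm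
    obtain ⟨p, q, r, rfl⟩ : ∃ p q r, m = eG3 p q r := ⟨m 0, m 1, m 2, (eG3_eta m).symm⟩
    rw [wt_w211_eG3] at hm
    have hcases : (p = 0 ∧ q = 0 ∧ r = 0) ∨ (p = 0 ∧ q = 1 ∧ r = 0) ∨ (p = 0 ∧ q = 0 ∧ r = 1) := by omega
    rcases hcases with ⟨rfl, rfl, rfl⟩ | ⟨rfl, rfl, rfl⟩ | ⟨rfl, rfl, rfl⟩ <;>
      simp [hC₁, hmz, coeff_monomial, eG3_eq_iff, hZ0, hq₁', hq₂']
  have hmywt : ∀ m ∈ my.support, wt Ω m = 1 := by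
    refine wtEq_add ?_ ?_
    · intro m hm; rw [wtEq_monomial Ω _ _ m hm, wt_w211_eG3]; norm_num
    · intro m hm; rw [wtEq_monomial Ω _ _ m hm, wt_w211_eG3]; norm_num
  have hmzwt : ∀ m ∈ mz.support, wt Ω m = 1 := by
    refine wtEq_add ?_ ?_
    · intro m hm; rw [wtEq_monomial Ω _ _ m hm, wt_w211_eG3]; norm_num
    · intro m hm; rw [wtEq_monomial Ω _ _ m hm, wt_w211_eG3]; norm_num
  have hmyge : ∀ m ∈ my.support, (1 : ℤ) ≤ wt Ω m := fun m hm => (hmywt m hm).symm.le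
  have hmzge : ∀ m ∈ mz.support, (1 : ℤ) ≤ wt Ω m := fun m hm => (hmzwt m hm).symm.le
  have hY₁eq : Y₁ = my + B₁ := by rw [hB₁]; ring
  have hZ₁eq : Z₁ = mz + C₁ := by rw [hC₁]; ring
  have hY₁wt : ∀ m ∈ Y₁.support, (1 : ℤ) ≤ wt Ω m := by
    rw [hY₁eq]; exact wtGe_add hmyge (wtGe_mono (by norm_num) hB₁wt)
  have hZ₁wt : ∀ m ∈ Z₁.support, (1 : ℤ) ≤ wt Ω m := by
    rw [hZ₁eq]; exact wtGe_add hmzge (wtGe_mono (by norm_num) hC₁wt)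
  -- the candidate initial form `g₀ = m_z² (m_y⁴ + m_z⁴)`
  set g₀ := mz ^ 2 * (my ^ 4 + mz ^ 4) with hg₀
  have hg₀wt : ∀ m ∈ g₀.support, wt Ω m = 6 := by
    intro m hm
    rw [wtEq_mul (wtEq_pow hmzwt 2) (wtEq_add (wtEq_pow hmywt 4) (wtEq_pow hmzwt 4)) m hm]; norm_num
  -- `g₀ ≠ 0`: `m_z ≠ 0` (a coefficient) and `m_y⁴ + m_z⁴ ≠ 0` (evaluate where `m_z = 0 ≠ m_y`)
  have hmz0 : mz ≠ 0 := by
    intro h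
    have : coeff (eG3 0 1 0) mz = 0 := by rw [h, coeff_zero]
    simp [hmz, coeff_monomial, eG3_eq_iff] at this
    exact hq₁ this
  have hsum0 : my ^ 4 + mz ^ 4 ≠ 0 := by
    intro h
    have h1 := congrArg (eval (![0, q₂, -q₁] : Fin 3 → k)) h
    have emy : eval (![0, q₂, -q₁] : Fin 3 → k) my = p₁ * q₂ - q₁ * p₂ := by
      simp [hmy, monomial_eG3]; ring
    have emz : eval (![0, q₂, -q₁] : Fin 3 → k) mz = 0 := by
      simp [hmz, monomial_eG3]; ring
    rw [map_add, map_pow, map_pow, emy, emz, map_zero, zero_pow four_ne_zero, add_zero] at h1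
    exact hδ (pow_eq_zero_iff four_ne_zero |>.mp h1)
  have hg₀0 : g₀ ≠ 0 := mul_ne_zero (pow_ne_zero 2 hmz0) hsum0
  -- the remainder
  set qq := X₁ ^ 2 + Y₁ ^ 2 * Z₁ with hqq
  set D := X₁ ^ 2 + B₁ * (Y₁ + my) * Z₁ + my ^ 2 * C₁ with hD
  set S₆ := Z₁ ^ 5 + Z₁ ^ 4 * mz + Z₁ ^ 3 * mz ^ 2 + Z₁ ^ 2 * mz ^ 3 + Z₁ * mz ^ 4 + mz ^ 5 with hS₆
  have hDwt : ∀ m ∈ D.support, (4 : ℤ) ≤ wt Ω m := by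
    refine wtGe_add (wtGe_add ?_ ?_) ?_
    · have := wtGe_pow hX₁wt 2; exact wtGe_mono (by norm_num) this
    · have := wtGe_mul (wtGe_mul hB₁wt (wtGe_add hY₁wt hmyge)) hZ₁wt; exact wtGe_mono (by norm_num) this
    · have := wtGe_mul (wtGe_pow hmyge 2) hC₁wt; exact wtGe_mono (by norm_num) this
  have hqqwt : ∀ m ∈ (qq + my ^ 2 * mz).support, (3 : ℤ) ≤ wt Ω m := by
    refine wtGe_add (wtGe_add ?_ ?_) ?_
    · have := wtGe_pow hX₁wt 2; exact wtGe_mono (by norm_num) this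
    · have := wtGe_mul (wtGe_pow hY₁wt 2) hZ₁wt; exact wtGe_mono (by norm_num) this
    · have := wtGe_mul (wtGe_pow hmyge 2) hmzge; exact wtGe_mono (by norm_num) this
  have hS₆wt : ∀ m ∈ S₆.support, (5 : ℤ) ≤ wt Ω m := by
    refine wtGe_add (wtGe_add (wtGe_add (wtGe_add (wtGe_add ?_ ?_) ?_) ?_) ?_) ?_
    · have := wtGe_pow hZ₁wt 5; exact wtGe_mono (by norm_num) this
    · have := wtGe_mul (wtGe_pow hZ₁wt 4) hmzge; exact wtGe_mono (by norm_num) this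
    · have := wtGe_mul (wtGe_pow hZ₁wt 3) (wtGe_pow hmzge 2); exact wtGe_mono (by norm_num) this
    · have := wtGe_mul (wtGe_pow hZ₁wt 2) (wtGe_pow hmzge 3); exact wtGe_mono (by norm_num) this
    · have := wtGe_mul hZ₁wt (wtGe_pow hmzge 4); exact wtGe_mono (by norm_num) this
    · have := wtGe_pow hmzge 5; exact wtGe_mono (by norm_num) this
  set r := D * (qq + my ^ 2 * mz) + C₁ * S₆ + X₁ ^ 5 + X₁ * Y₁ ^ 8 + X₁ ^ 10 + Y₁ ^ 10 + Z₁ ^ 10 with hr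
  have hrwt : ∀ m ∈ r.support, (6 : ℤ) + 1 ≤ wt Ω m := by
    refine wtGe_add (wtGe_add (wtGe_add (wtGe_add (wtGe_add (wtGe_add ?_ ?_) ?_) ?_) ?_) ?_) ?_
    · have := wtGe_mul hDwt hqqwt; exact wtGe_mono (by norm_num) this
    · have := wtGe_mul hC₁wt hS₆wt; exact wtGe_mono (by norm_num) this
    · have := wtGe_pow hX₁wt 5; exact wtGe_mono (by norm_num) this
    · have := wtGe_mul hX₁wt (wtGe_pow hY₁wt 8); exact wtGe_mono (by norm_num) this
    · have := wtGe_pow hX₁wt 10; exact wtGe_mono (by norm_num) this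
    · have := wtGe_pow hY₁wt 10; exact wtGe_mono (by norm_num) this
    · have := wtGe_pow hZ₁wt 10; exact wtGe_mono (by norm_num) this
  have hg : aeval φ (specimenS10 k) = g₀ + r := by
    rw [aeval_specimenS10, ← hX₁, ← hY₁, ← hZ₁, hr, hg₀, hD, hS₆, hqq, hB₁, hC₁]
    ring
  have hin : initialForm Ω (aeval φ (specimenS10 k)) = mz ^ 2 * (my ^ 4 + mz ^ 4) :=
    initialForm_eq_of_add_wtGe Ω hg hg₀0 hg₀wt hrwt
  have ha : eG3 0 1 0 ∈ mz.support := by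
    rw [mem_support_iff]; simp [hmz, coeff_monomial, eG3_eq_iff]; exact hq₁
  have hb : eG3 0 0 1 ∈ mz.support := by
    rw [mem_support_iff]; simp [hmz, coeff_monomial, eG3_eq_iff]; exact hq₂
  exact not_isLocallyND_of_initialForm_eq_sq_mul hΩpos hin ha hb (by simp [eG3_eq_iff])


end S10AllFrames

end Summit.ResolutionOfSingularities.ResolutionOfSingularities.Cruxes.EquisingularLiftNat.Sections

end
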